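import Summits.ValiantsHypothesis.ValiantsHypothesis.Theses.ElementaryWordLength
import Summits.ValiantsHypothesis.ValiantsHypothesis.Theorems.HubHub

/-!
# Route ElementaryWordLength — item `Assembly`

Item `stmt-ValiantsHypothesis-6631` (assembly of route `ElementaryWordLength`): pure bookkeeping.
Given (1) `VpWordQp` ("every `VP` family has affine elementary words of quasi-polynomial length",
`VP ⊆ VQF` in word form; Valiant–Skyum–Berkowitz–Rackoff 1983 + Ben-Or–Cleve 1992, taken here as a
hypothesis exactly as the route decl states it), (2) the route target `WordLengthQP` ("the
transvection `E_13(per_n)` has no quasi-polynomial-length affine elementary words"), (3) the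
renaming bridge `perFamily ℂ ∈ VP ℂ ↔ IsVPFamily (fun n => perPoly (Fin n) ℂ)` and (4) Valiant's
`perFamily ℂ ∈ VNP ℂ`, conclude `ValiantsHypothesis` (`VP ℂ ≠ VNP ℂ`).
Proof: by (1) and (2) the permanent family is not a `VP` family (a `VP` permanent would have
quasi-polynomial words by (1), contradicting (2)); the landed hub lemma
`Summit.ValiantsHypothesis.Hub.valiantsHypothesis_of_not_isVPFamily_per` (Theorems/HubHub.lean)
turns this, the bridge and `per ∈ VNP` into `VP ℂ ≠ VNP ℂ`.
-/

namespace Summit.ValiantsHypothesis.Theorems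

open Literature.Computability.AlgebraicComplexity

/-- **Assembly** (route ElementaryWordLength, item `stmt-ValiantsHypothesis-6631`):
`VpWordQp → WordLengthQP → (renaming bridge for the permanent family) → per ∈ VNP →
ValiantsHypothesis`. Bookkeeping: the first two hypotheses say the permanent family over `ℂ` is
not a `VP` family (a `VP` permanent would have quasi-polynomial-length elementary words for
`E_13(per_n)`, which `WordLengthQP` denies), and the hub lemma
`valiantsHypothesis_of_not_isVPFamily_per` finishes. [folklore] -/
theorem elementaryWordLength_assembly_proof :
    Summit.ValiantsHypothesis.ValiantsHypothesis.Theses.ElementaryWordLength.Assembly := by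
  unfold Summit.ValiantsHypothesis.ValiantsHypothesis.Theses.ElementaryWordLength.Assembly
  intro hVpWordQp hWordLengthQP hbridge hVNP
  refine Summit.ValiantsHypothesis.Hub.valiantsHypothesis_of_not_isVPFamily_per ?_ hbridge hVNP
  intro hper
  exact hWordLengthQP (hVpWordQp _ hper)

end Summit.ValiantsHypothesis.Theorems
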